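import Mathlib
import HarnessLib
import Literature.Analysis.FluidPDE.Tao2016AveragedNS.RenormalisedCascadeWaves
import Literature.Analysis.FluidPDE.Tao2016AveragedNS.SelfSimilarCascadeBlowup

/-!
# Route `TaoLadderRungTwoBreak`, crux `NoSurvivingDSSOne` (stmt-NavierStokesRegularity-20205):
# registered stub `stub_embedSurviving` of the birth skeleton `NoSurvivingDSSOne_birth.lean`
# (sha16 `73b53d2f2a6a7842`) closed BY NAME

The registered skeleton of K1(1) has two stubs: `stub_embedSurviving` (a non-trivial (S₁)-surviving
admissible DSS wave of a table embeds, shell-wise, as an admissible inviscid ETERNAL solution of the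
renormalised lattice that is (S₁)-surviving FORWARD) and `stub_eternalLiouville` (the eternal Liouville
theorem K1^∞_fwd(·,1), the hard transfer stub).  This file proves the first one VERBATIM (signature as
registered on the item 2026-08-27T09:40:06Z) from the two tree lemmas
`TaoCascade.IsDSSWave.isEternal_dssEmbed` and `TaoCascade.eternalSurvivingFwd_dssEmbed`
(module `Tao2016AveragedNS.SelfSimilarCascadeBlowup`).

HONEST LABEL: bookkeeping-grade (two tree lemmas assembled); MODEL lattice of Tao 2016 §4 in the
log-time variables of §6.4 only; `stub_eternalLiouville`, the crux `NoSurvivingDSSOne` and every NS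
statement remain OPEN; nothing here bears on the summit.
-/

noncomputable section

-- the summit and its single sub-problem share the name (CONVENTIONS §1)
set_option linter.dupNamespace false

namespace Summit.NavierStokesRegularity.NavierStokesRegularity.Theorems.NoSurvivingDSSOne.Birth

open Literature.Analysis.FluidPDE Literature.Analysis.FluidPDE.TaoCascade

/-- **Registered stub `stub_embedSurviving` (crux `NoSurvivingDSSOne`, skeleton `73b53d2f2a6a7842`),
signature verbatim.**  A profile family `Φ` of an admissible DSS wave of the table `α` at scale ratio
`1+ε₀` (shape permutation `π`, delay `T`) with `Φ r₀ x₀ ≠ 0` and (S₁)-surviving delay embeds along the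
orbit of `r₀` (`dssEmbed π T Φ r₀ : ℤ → ℝ → Em 4`, shell `n` carrying the profile `π^n r₀` at phase
`σ − nT`) as an admissible inviscid eternal solution of the renormalised lattice (`IsEternal`) which is
(S₁)-surviving forward (`EternalSurvivingFwd 1`).  Proof: the tree lemmas
`IsDSSWave.isEternal_dssEmbed` and `eternalSurvivingFwd_dssEmbed`.
[cite: Tao2016AveragedNS, §4 (4.1)–(4.4) and §6.4 (self-similar variables); cell vocabulary] -/
theorem stub_embedSurviving :
    ∀ (ε₀ : ℝ) (α : (Fin 4 → Fin 4 → Fin 4 → ℤ × ℤ × ℤ → ℝ)) (q : ℕ) (π : Equiv.Perm (Fin q))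
      (T : ℝ) (Φ : Fin q → ℝ → Literature.Analysis.FluidPDE.TaoCascade.Em 4) (r₀ : Fin q) (x₀ : ℝ),
      0 < ε₀ → Literature.Analysis.FluidPDE.TaoCascade.IsDSSWave ε₀ α π T Φ →
      Literature.Analysis.FluidPDE.TaoCascade.Surviving 1 ε₀ T → Φ r₀ x₀ ≠ 0 →
      Literature.Analysis.FluidPDE.TaoCascade.IsEternal ε₀ α
          (Literature.Analysis.FluidPDE.TaoCascade.dssEmbed π T Φ r₀) ∧
        Literature.Analysis.FluidPDE.TaoCascade.EternalSurvivingFwd 1 ε₀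
          (Literature.Analysis.FluidPDE.TaoCascade.dssEmbed π T Φ r₀) :=
  fun _ε₀ _α _q _π _T _Φ r₀ _x₀ hε₀ hW hS hne =>
    ⟨hW.isEternal_dssEmbed r₀, eternalSurvivingFwd_dssEmbed hε₀ hW.delay_pos hS hne⟩

end Summit.NavierStokesRegularity.NavierStokesRegularity.Theorems.NoSurvivingDSSOne.Birth

end
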